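import Summits.QuantumFields.BalabanUV.T4Continuum.Support.ShellMeasureLinearizedGammaT
import Summits.QuantumFields.BalabanUV.T4Continuum.Support.ShellMeasureAverageAnalyticB7
import Summits.QuantumFields.BalabanUV.T4Continuum.Support.ShellMeasureAverageHStructure
import Summits.QuantumFields.BalabanUV.T4Continuum.Support.ShellMeasureEquivariantGerm

/-!
# `T4Continuum.ShellMeasureLinearizedGammaTEnd` — NE7c-S52 file 2∕2, THE ASSEMBLY (END): (LR)_j REAL-FORM CHART DATA
# FOR THE PRINTED BLOCK AVERAGE [B7] (15) FROM PRINT'S HYPOTHESES ALONE — every analytic input of row S46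
# DISCHARGED: (Q1)–(Q3) by S49 f2, (Q4) by S51 ∘ S47, `hop`∕`hLQh`∕`hHop` by S48, `hhop` by S50 f2; abstract
# finite-dimensional C⋆-algebra AND the matrix typing `M_N(ℂ)`
(cell `pub-balaban`, sub-cell `t4`, spine estimate NE7c (node U5b); NE7c ROUND-2 crew `t4-ne7c-formalise-*`, seat
`b2b-balaban-t4-ne7c-formalise-leaf-08` gen 10; owner table `t4/b2b-balaban-t4-ne7c-p1/LEAVES-NE7c-P1.md` v2.2 ROW S52,
BOOKED → leaf-08-g10; imports file 1 `ShellMeasureLinearizedGammaT` (hence S46, S48 f1), S49 f2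
`ShellMeasureAverageAnalyticB7` (p219014), S50 f2 `ShellMeasureAverageHStructure` (p219172; hence S47
`ShellMeasureAverageReal` p218692) and S51 `ShellMeasureEquivariantGerm` (p219081) ONLY, all BY NAME; [folklore];
0 `def`, 0 `def … : Prop`, 0 sorry, 0 citations — «p. 267», «(15)» LOCATE displayed shapes)

HONEST FRAMING.  Finite four-torus programme, rung (B)+1 only — NOT infinite volume, NOT a mass gap, NOT the Clay
problem, NOT summit progress; (B), `BetaPertHyp`, (B^μ) not consumed.  NE7c (`T4IndicatorShell.ShellWeightBound`) is
NOT PRINTED and NOT PROVED; «NE7c ⇐ the named binders» (trigger c3).  Nothing of [Balaban 1983–89] is asserted: the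
printed average (2.4)∕[Balaban1985Averaging] (15) and p. 267's `h` are the tree's typed `B12AverageCorridor267`
objects (corner cubes on `ℤᵈ`, DIVERGENCE D-b12g20.1), and the HYPOTHESES of the END are EXACTLY those of the tree
theorem `B12AverageCorridor267.h_paragraph_p267_gammaT` (`0 < L`; unit bounds `‖V b‖, ‖(V b)⁻¹‖ ≤ 1`; off-axis block
loops `‖W_x(V) − 1‖ ≤ ε`, `0 ≤ ε ≤ 1∕8`, at every coarse bond; the Neumann budget `(Lᵈ∕L)·24ε < 1`) PLUS unitarity of the
bond variables (for the ⋆-structure) PLUS the two window numerics (`window_ok` of file 1 inhabits them explicitly).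
WHAT THIS DISCHARGES: the ANALYTIC half of WALL-NE7c-P1 §3 W-d («linearizability of the block average about the step's
background on the window, B12 p. 267 TYPE») FOR THE PRINTED AVERAGE (15): after this file the (LR)_j road of record
(S33 ∘ S36∕S40) receives its real chart data from print's located hypotheses by ONE theorem.  WHAT REMAINS of W-d: the
[dict] identification of a live slot's fibre with the fibre of THIS average about the step's background (node O,
constructed by nobody); W-a, W-b, W-c, W-e are untouched.  NOTHING in the countdown moves; NE7c NOT PROVED; spine
PROVED 0/9.  HONEST DEPENDENCY (cell, verbatim): continuum YM on T⁴ ⇐ BetaPertH ∧ nine spine estimates (0/9 proved);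
BetaPertH ⇐ (D1) ∧ (D4) ∧ CAP+tail; G-an2-4 gates asym, D1 and NE2/3/4.

CONTENT.
* §1 **`QtΓ_conj`** — (Q4) on the WHOLE analyticity ball `‖B‖ < 1∕(2816(d+1)L)` of S49 f2: row S51's germ propagation
  `conj_eqOn_ball_of_regime'` (identity principle over `ℝ`) fed by row S47's `star_Qtilde_gammaT` (the ⋆-identity in
  the `mlog` regime `≤ 1∕3`), the regime quantities being continuous in `B` (S49's `ExpWord`s ∕ exponent analyticity)
  and STRICTLY in the regime at `B = 0` (`≤ ε ≤ 1∕8 < 1∕3`; the quotient `= 1`) — RULING R-ne7cp1-g28-2's route.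
* §2 **`realForm_chartData_gammaT`** — THE END: file 1's core `realForm_chartData_gammaT_of` with (Q1) :=
  `analyticOnNhd_Qtilde_gammaT`, (Q3) := `norm_Qtilde_gammaT_le` (`M_Q = 1` on the ball), (Q4) := §1, and the fibre
  ⋆-identity := S50 f2 `hGen_star_gammaT_unitary`; stated with file 1's reducible names `TΓ`∕`hΓ`∕`winΓ`∕`DtΓℝ`
  (`realForm_chart_eq` is the `rfl` bridge to S40's spelling); **`realForm_chartData_gammaT_explicit`** — the same with
  the window radius `εw := R²∕(18b + 3R + 1)` CHOSEN (`window_ok`) and the splitting `Ψ` SUPPLIED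
  (`exists_splitting_gammaT`): hypotheses = print's + unitarity, NOTHING ELSE.
* §3 **`realForm_chartData_gammaT_matrix`** — the matrix typing `𝔸 := Matrix (Fin N) (Fin N) ℂ` (L²-operator norm,
  `N ≠ 0`) of the owner's row text: every class is found by instance resolution (Borel structures by hypothesis, as in
  S40∕S46).
-/

noncomputable section

open Set Metric Filter Topology

namespace Summit.QuantumFields.BalabanUV.T4Continuum.ShellMeasureLinearizedGammaT

open Literature.MathematicalPhysics.QuantumFieldTheory.Balaban1983to89
open Literature.MathematicalPhysics.QuantumLattice (ZdEdge blockSites)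
open B7BlockGeometry (qppBonds)
open B13CorridorSeparation (b0Z)
open B12HOperator267 (gammaT)
open B12AverageCorridor267 (Qtilde pert pert_zero loopW avgM Ustr expU offAxis isBlockLocal_gammaT
  isAxisStraightFamily_gammaT hGen)
open Summit.QuantumFields.BalabanUV.Beta.LinearizingChange267FromQ (nonlin Mq)
open ShellMeasureLinearizedRealStructure (realSub incl reP)
open ShellMeasureAverageAnalytic (ExpWord)
open ShellMeasureAverageAnalyticB7 (pert_extend_zero expWord_gammaT expWord_loopW expWord_Ustr loops_small_gammaT
  exponent_analytic_and_bounded analyticOnNhd_Qtilde_gammaT norm_Qtilde_gammaT_le)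
open ShellMeasureAverageReal (star_Qtilde_gammaT)
open ShellMeasureAverageHStructure (hGen_star_gammaT_unitary)
open ShellMeasureEquivariantGerm (conj_eqOn_ball_of_regime' norm_sub_one_lt_of_eq_one)

variable {d : ℕ} {𝔸 : Type*} [NormedRing 𝔸] [NormedAlgebra ℂ 𝔸] [CompleteSpace 𝔸] [NormOneClass 𝔸]
  [StarRing 𝔸] [CStarRing 𝔸] [StarModule ℂ 𝔸] {L : ℕ} {c : ZdEdge d}

/-! ## §1 (Q4) for the printed average on its analyticity ball -/

/-- **(Q4) FOR THE PRINTED AVERAGE ON ITS WHOLE ANALYTICITY BALL** — the route of record (RULING R-ne7cp1-g28-2): row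
S51's germ propagation `conj_eqOn_ball_of_regime'` fed by row S47's `star_Qtilde_gammaT` (the three `mlog`-regime
quantities — the block loops of `V′V`, those of `V`, the quotient `M_c(V′V)M_c(V)⁻¹` — are continuous in `B′`
(S49's `ExpWord`s) and STRICTLY in the regime at `B′ = 0`: `≤ ε ≤ 1∕8 < 1∕3`, resp. `= 1`). [folklore] -/
theorem QtΓ_conj (hL : 0 < L) {V : ZdEdge d → 𝔸ˣ} (hVu : ∀ b, (V b : 𝔸) ∈ unitary 𝔸)
    (hV : ∀ b, ‖((V b : 𝔸ˣ) : 𝔸)‖ ≤ 1) (hV' : ∀ b, ‖(((V b)⁻¹ : 𝔸ˣ) : 𝔸)‖ ≤ 1) {ε : ℝ} (hε0 : 0 ≤ ε) (hε : ε ≤ 1 / 8)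
    (hW : ∀ x ∈ offAxis L c, ‖((loopW L (fun U : ZdEdge d → 𝔸ˣ => gammaT L U) V c x : 𝔸ˣ) : 𝔸) - 1‖ ≤ ε) :
    ∀ B ∈ ball (0 : ↥(qppBonds L c) → 𝔸) (1 / (2816 * ((d : ℝ) + 1) * L)),
      QtΓ L V c (κΓ 𝔸 L c B) = κ𝔸 𝔸 (QtΓ L V c B) := by
  have hall : ∀ x ∈ blockSites L c.1, ‖((loopW L (fun U : ZdEdge d → 𝔸ˣ => gammaT L U) V c x : 𝔸ˣ) : 𝔸) - 1‖ ≤ ε :=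
    loops_small_gammaT hL hε0 hW
  have h13 : ε < 1 / 3 := by linarith
  refine conj_eqOn_ball_of_regime' (blockSites L c.1)
    (W := fun x (B : ↥(qppBonds L c) → 𝔸) => ((loopW L (fun U : ZdEdge d → 𝔸ˣ => gammaT L U)
      (pert (Function.extend Subtype.val B (0 : ZdEdge d → 𝔸)) V) c x : 𝔸ˣ) : 𝔸))
    (Z := fun B : ↥(qppBonds L c) → 𝔸 => ((avgM L (fun U : ZdEdge d → 𝔸ˣ => gammaT L U)
      (pert (Function.extend Subtype.val B (0 : ZdEdge d → 𝔸)) V) c *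
      (avgM L (fun U : ZdEdge d → 𝔸ˣ => gammaT L U) V c)⁻¹ : 𝔸ˣ) : 𝔸)) (r := 1 / 3)
    (analyticOnNhd_Qtilde_gammaT hL hV hV' hε0 hε hW) ?_ ?_ ?_ ?_ ?_
  · -- S47: the ⋆-identity in the regime
    intro B hWB hZB
    show star (Qtilde L _ V _ c) = Qtilde L _ V (Function.extend Subtype.val (star B) (0 : ZdEdge d → 𝔸)) c
    rw [extend_star]
    exact star_Qtilde_gammaT hVu _ c hWB (fun x hx => (hall x hx).trans (by linarith)) hZB
  · -- continuity of the loops at 0 (S49's words are entire)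
    intro x _
    exact ((expWord_loopW hV hV' (expWord_gammaT hL hV hV') x).an 0).continuousAt
  · -- strict regime of the loops at 0
    intro x hx
    show ‖((loopW L _ (pert (Function.extend Subtype.val (0 : ↥(qppBonds L c) → 𝔸) (0 : ZdEdge d → 𝔸)) V) c x
      : 𝔸ˣ) : 𝔸) - 1‖ < 1 / 3
    rw [pert_extend_zero]
    exact (hall x hx).trans_lt h13
  · -- continuity of the quotient at 0: `M_c(V′V) = e^{S(B)}·T(B)` with `S` analytic at `0` (S49 f2) and `T` entire
    have hLr : (1 : ℝ) ≤ L := by exact_mod_cast hL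
    have hS := (exponent_analytic_and_bounded (c := c) (w𝒯 := (d : ℝ) * L) hL hV hV' (by positivity)
      (expWord_gammaT hL hV hV') hε hall 0
      (show ‖(0 : ↥(qppBonds L c) → 𝔸)‖ < 1 / (32 * (2 * ((d : ℝ) * L) + 2 * L)) by
        rw [norm_zero]; positivity)).1
    have hT := (expWord_Ustr (L := L) (c := c) hV hV' c).an 0
    have hA : AnalyticAt ℂ (fun B : ↥(qppBonds L c) → 𝔸 => ((avgM L (fun U : ZdEdge d → 𝔸ˣ => gammaT L U)
        (pert (Function.extend Subtype.val B (0 : ZdEdge d → 𝔸)) V) c : 𝔸ˣ) : 𝔸)) 0 :=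
      ((NormedSpace.exp_analytic _).comp_of_eq hS rfl).mul hT
    exact (hA.continuousAt.mul continuousAt_const)
  · -- the quotient is 1 at 0
    have h1 : ((avgM L (fun U : ZdEdge d → 𝔸ˣ => gammaT L U)
        (pert (Function.extend Subtype.val (0 : ↥(qppBonds L c) → 𝔸) (0 : ZdEdge d → 𝔸)) V) c *
        (avgM L (fun U : ZdEdge d → 𝔸ˣ => gammaT L U) V c)⁻¹ : 𝔸ˣ) : 𝔸) = 1 := by
      rw [pert_extend_zero, mul_inv_cancel, Units.val_one]
    exact norm_sub_one_lt_of_eq_one (r := 1 / 3)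
      (Z := fun B : ↥(qppBonds L c) → 𝔸 => ((avgM L (fun U : ZdEdge d → 𝔸ˣ => gammaT L U)
        (pert (Function.extend Subtype.val B (0 : ZdEdge d → 𝔸)) V) c *
        (avgM L (fun U : ZdEdge d → 𝔸ˣ => gammaT L U) V c)⁻¹ : 𝔸ˣ) : 𝔸)) h1 (by norm_num)


/-! ## §2 THE END — print's hypotheses only -/

section End

/-- the `rfl` bridge: file 1's reducible names spell S40∕S46's real chart `B ↦ B − h (D̃_ℝ B)` verbatim. [folklore] -/
theorem realForm_chart_eq (hL : 0 < L) (V : ZdEdge d → 𝔸ˣ) {ε : ℝ} (hε0 : 0 ≤ ε) (hε : ε ≤ 1 / 8)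
    (hW : ∀ c', ∀ x ∈ offAxis L c', ‖((loopW L (fun U : ZdEdge d → 𝔸ˣ => gammaT L U) V c' x : 𝔸ˣ) : 𝔸) - 1‖ ≤ ε)
    (hV : ∀ b, ‖((V b : 𝔸ˣ) : 𝔸)‖ ≤ 1) (hV' : ∀ b, ‖(((V b)⁻¹ : 𝔸ˣ) : 𝔸)‖ ≤ 1)
    (hbud : (L : ℝ) ^ d / L * (24 * ε) < 1) (Dt : (↥(qppBonds L c) → 𝔸) → 𝔸) (εw : ℝ) :
    (fun B : realSub (κΓ 𝔸 L c) => B - hΓ hL V hε0 hε hW hV hV' hbud c (DtΓℝ L c Dt εw B))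
      = fun B : realSub (κΓ 𝔸 L c) => B - (reP (κΓ 𝔸 L c) κΓ_invol ∘L
          ((hopΓ hL V hε0 hε hW hV hV' hbud c).mkContinuous _ (norm_hopΓ_le hL V hε0 hε hW hV hV' hbud c)).restrictScalars ℝ
          ∘L incl (κ𝔸 𝔸)) (({y : realSub (κΓ 𝔸 L c) | ‖incl (κΓ 𝔸 L c) y‖ < εw}).piecewise
            (fun y => reP (κ𝔸 𝔸) κ𝔸_invol (Dt (incl (κΓ 𝔸 L c) y))) 0 B) := rfl

variable [FiniteDimensional ℂ 𝔸] [MeasurableSpace 𝔸] [BorelSpace 𝔸] [MeasurableSpace (↥(qppBonds L c) → 𝔸)]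
  [BorelSpace (↥(qppBonds L c) → 𝔸)]

/-- **NE7c-S52 — (LR)_j REAL-FORM CHART DATA FOR [B7] (15) FROM PRINT'S HYPOTHESES ALONE.**  In a finite-dimensional
C⋆-algebra `𝔸` (e.g. `M_N(ℂ)`, §3), for a UNITARY background `V` with unit bounds, `ε`-regular off-axis block loops at
every coarse bond (`0 ≤ ε ≤ 1∕8`) and the Neumann budget `(Lᵈ∕L)·24ε < 1` — EXACTLY `h_paragraph_p267_gammaT`'s
hypotheses + unitarity — and a window radius `εw` with `9·(Mq R 1)·b·εw < 1`, `3εw ≤ R` (`R := 1∕(2816(d+1)L)`,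
`b := (Lᵈ∕L)∕(1 − (Lᵈ∕L)·24ε)`): for every real splitting `Ψ` of `TΓ` (the real form of `DQ̃(0)`) there is `D̃` such that
(i) `D̃ B` lies in the ball `4·(Mq R 1)·εw²`, solves print's fixed-point equation `C̃(B − h D̃(B)) = D̃(B)` for the DERIVED
`C̃ := Q̃ − DQ̃(0)`, and `Q̃(B − h D̃(B)) = DQ̃(0) B` («the transformation B′ = B − hD̃(B) linearizes Q̃»), on `‖B‖ < εw`;
(ii)–(v) S40's FOUR real-chart clauses on the Hermitian window `winΓ εw`: the real chart `B ↦ B − hΓ (D̃_ℝ B)` is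
MEASURABLE, INJECTIVE on the window, has the derivative `id − hΓ ∘ (reP ∘ DD̃(ι B)↾ℝ ∘ incl)` within it, and LINEARIZES
the real average `TΓ + C̃_ℝ` into `(Ψ.symm ·).2`.  (Q1)(Q3): S49 f2; (Q2): file 1; (Q4): §1; `hop`∕`hLQh`∕`hHop`: S48;
`hhop`: S50 f2; the END: S46 via file 1's core. [folklore] -/
theorem realForm_chartData_gammaT (hL : 0 < L) {V : ZdEdge d → 𝔸ˣ} (hVu : ∀ b, (V b : 𝔸) ∈ unitary 𝔸)
    (hV : ∀ b, ‖((V b : 𝔸ˣ) : 𝔸)‖ ≤ 1) (hV' : ∀ b, ‖(((V b)⁻¹ : 𝔸ˣ) : 𝔸)‖ ≤ 1) {ε : ℝ} (hε0 : 0 ≤ ε) (hε : ε ≤ 1 / 8)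
    (hW : ∀ c', ∀ x ∈ offAxis L c', ‖((loopW L (fun U : ZdEdge d → 𝔸ˣ => gammaT L U) V c' x : 𝔸ˣ) : 𝔸) - 1‖ ≤ ε)
    (hbud : (L : ℝ) ^ d / L * (24 * ε) < 1) {εw : ℝ}
    (hq : 9 * Mq (1 / (2816 * ((d : ℝ) + 1) * L)) 1 * (((L : ℝ) ^ d / L) / (1 - (L : ℝ) ^ d / L * (24 * ε))) * εw < 1)
    (hRC : 3 * εw ≤ 1 / (2816 * ((d : ℝ) + 1) * L))
    {Kf : Type*} [NormedAddCommGroup Kf] [NormedSpace ℝ Kf] (Ψ : (Kf × realSub (κ𝔸 𝔸)) ≃L[ℝ] realSub (κΓ 𝔸 L c))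
    (hΨ : ∀ y, (Ψ.symm y).2 = TΓ L V c y) :
    ∃ Dt : (↥(qppBonds L c) → 𝔸) → 𝔸,
      (∀ B : ↥(qppBonds L c) → 𝔸, ‖B‖ < εw →
        Dt B ∈ closedBall (0 : 𝔸) (4 * Mq (1 / (2816 * ((d : ℝ) + 1) * L)) 1 * εw ^ 2) ∧
        nonlin (QtΓ L V c) (B - hopΓ hL V hε0 hε hW hV hV' hbud c (Dt B)) = Dt B ∧
        QtΓ L V c (B - hopΓ hL V hε0 hε hW hV hV' hbud c (Dt B)) = fderiv ℂ (QtΓ L V c) 0 B) ∧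
      Measurable (fun B : realSub (κΓ 𝔸 L c) => B - hΓ hL V hε0 hε hW hV hV' hbud c (DtΓℝ L c Dt εw B)) ∧
      InjOn (fun B : realSub (κΓ 𝔸 L c) => B - hΓ hL V hε0 hε hW hV hV' hbud c (DtΓℝ L c Dt εw B)) (winΓ L c εw) ∧
      (∀ B ∈ winΓ L c εw, HasFDerivWithinAt
          (fun B : realSub (κΓ 𝔸 L c) => B - hΓ hL V hε0 hε hW hV hV' hbud c (DtΓℝ L c Dt εw B))
          (ContinuousLinearMap.id ℝ (realSub (κΓ 𝔸 L c)) - (hΓ hL V hε0 hε hW hV hV' hbud c).comp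
            (reP (κ𝔸 𝔸) κ𝔸_invol ∘L (fderiv ℂ Dt (incl (κΓ 𝔸 L c) B)).restrictScalars ℝ ∘L incl (κΓ 𝔸 L c)))
          (winΓ L c εw) B) ∧
      ∀ B ∈ winΓ L c εw,
        TΓ L V c (B - hΓ hL V hε0 hε hW hV hV' hbud c (DtΓℝ L c Dt εw B)) +
          (fun y => reP (κ𝔸 𝔸) κ𝔸_invol (nonlin (QtΓ L V c) (incl (κΓ 𝔸 L c) y)))
            (B - hΓ hL V hε0 hε hW hV hV' hbud c (DtΓℝ L c Dt εw B)) = (Ψ.symm B).2 := by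
  have hLr : (0 : ℝ) < L := by exact_mod_cast hL
  have hR : (0 : ℝ) < 1 / (2816 * ((d : ℝ) + 1) * L) := by positivity
  have hQM : ∀ B ∈ ball (0 : ↥(qppBonds L c) → 𝔸) (1 / (2816 * ((d : ℝ) + 1) * L)), ‖QtΓ L V c B‖ ≤ 1 := by
    intro B hB
    rw [mem_ball_zero_iff] at hB
    refine (norm_Qtilde_gammaT_le hL hV hV' hε0 hε (hW c) hB).trans ?_
    have hK : (0 : ℝ) < 2816 * ((d : ℝ) + 1) * L := by positivity
    calc 2816 * ((d : ℝ) + 1) * L * ‖B‖ ≤ 2816 * ((d : ℝ) + 1) * L * (1 / (2816 * ((d : ℝ) + 1) * L)) :=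
          mul_le_mul_of_nonneg_left hB.le hK.le
      _ = 1 := mul_one_div_cancel hK.ne'
  exact realForm_chartData_gammaT_of hL hV hV' hε0 hε hW hbud hR (analyticOnNhd_Qtilde_gammaT hL hV hV' hε0 hε (hW c))
    hQM (QtΓ_conj hL hVu hV hV' hε0 hε (hW c)) (hGen_star_gammaT_unitary hL V hε0 hε hW hV hV' hbud hVu c) hq hRC Ψ hΨ

/-- **THE SAME, FULLY EXPLICIT — print's hypotheses + unitarity and NOTHING ELSE**: the window radius is CHOSEN,
`εw := R²∕(18b + 3R + 1)` with `R = 1∕(2816(d+1)L)`, `b = (Lᵈ∕L)∕(1 − (Lᵈ∕L)·24ε)` (file 1 `window_ok`), and the real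
splitting `Ψ` of `ker TΓ × Fix(⋆_𝔸) ≃ Fix(⋆)` is SUPPLIED (file 1 `exists_splitting_gammaT`). [folklore] -/
theorem realForm_chartData_gammaT_explicit (hL : 0 < L) {V : ZdEdge d → 𝔸ˣ} (hVu : ∀ b, (V b : 𝔸) ∈ unitary 𝔸)
    (hV : ∀ b, ‖((V b : 𝔸ˣ) : 𝔸)‖ ≤ 1) (hV' : ∀ b, ‖(((V b)⁻¹ : 𝔸ˣ) : 𝔸)‖ ≤ 1) {ε : ℝ} (hε0 : 0 ≤ ε) (hε : ε ≤ 1 / 8)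
    (hW : ∀ c', ∀ x ∈ offAxis L c', ‖((loopW L (fun U : ZdEdge d → 𝔸ˣ => gammaT L U) V c' x : 𝔸ˣ) : 𝔸) - 1‖ ≤ ε)
    (hbud : (L : ℝ) ^ d / L * (24 * ε) < 1) :
    ∃ (Ψ : (LinearMap.ker ((TΓ L V c : realSub (κΓ 𝔸 L c) →L[ℝ] realSub (κ𝔸 𝔸)) :
        realSub (κΓ 𝔸 L c) →ₗ[ℝ] realSub (κ𝔸 𝔸)) × realSub (κ𝔸 𝔸)) ≃L[ℝ] realSub (κΓ 𝔸 L c))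
      (Dt : (↥(qppBonds L c) → 𝔸) → 𝔸),
      (∀ y, (Ψ.symm y).2 = TΓ L V c y) ∧
      (∀ B : ↥(qppBonds L c) → 𝔸, ‖B‖ < (1 / (2816 * ((d : ℝ) + 1) * L)) ^ 2 /
          (18 * (((L : ℝ) ^ d / L) / (1 - (L : ℝ) ^ d / L * (24 * ε))) + 3 * (1 / (2816 * ((d : ℝ) + 1) * L)) + 1) →
        Dt B ∈ closedBall (0 : 𝔸) (4 * Mq (1 / (2816 * ((d : ℝ) + 1) * L)) 1 *
          ((1 / (2816 * ((d : ℝ) + 1) * L)) ^ 2 /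
            (18 * (((L : ℝ) ^ d / L) / (1 - (L : ℝ) ^ d / L * (24 * ε))) + 3 * (1 / (2816 * ((d : ℝ) + 1) * L)) + 1)) ^ 2) ∧
        nonlin (QtΓ L V c) (B - hopΓ hL V hε0 hε hW hV hV' hbud c (Dt B)) = Dt B ∧
        QtΓ L V c (B - hopΓ hL V hε0 hε hW hV hV' hbud c (Dt B)) = fderiv ℂ (QtΓ L V c) 0 B) ∧
      Measurable (fun B : realSub (κΓ 𝔸 L c) => B - hΓ hL V hε0 hε hW hV hV' hbud c (DtΓℝ L c Dt
        ((1 / (2816 * ((d : ℝ) + 1) * L)) ^ 2 /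
          (18 * (((L : ℝ) ^ d / L) / (1 - (L : ℝ) ^ d / L * (24 * ε))) + 3 * (1 / (2816 * ((d : ℝ) + 1) * L)) + 1)) B)) ∧
      InjOn (fun B : realSub (κΓ 𝔸 L c) => B - hΓ hL V hε0 hε hW hV hV' hbud c (DtΓℝ L c Dt
        ((1 / (2816 * ((d : ℝ) + 1) * L)) ^ 2 /
          (18 * (((L : ℝ) ^ d / L) / (1 - (L : ℝ) ^ d / L * (24 * ε))) + 3 * (1 / (2816 * ((d : ℝ) + 1) * L)) + 1)) B))
        (winΓ L c ((1 / (2816 * ((d : ℝ) + 1) * L)) ^ 2 /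
          (18 * (((L : ℝ) ^ d / L) / (1 - (L : ℝ) ^ d / L * (24 * ε))) + 3 * (1 / (2816 * ((d : ℝ) + 1) * L)) + 1))) ∧
      (∀ B ∈ winΓ L c ((1 / (2816 * ((d : ℝ) + 1) * L)) ^ 2 /
          (18 * (((L : ℝ) ^ d / L) / (1 - (L : ℝ) ^ d / L * (24 * ε))) + 3 * (1 / (2816 * ((d : ℝ) + 1) * L)) + 1)),
        HasFDerivWithinAt
          (fun B : realSub (κΓ 𝔸 L c) => B - hΓ hL V hε0 hε hW hV hV' hbud c (DtΓℝ L c Dt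
            ((1 / (2816 * ((d : ℝ) + 1) * L)) ^ 2 /
              (18 * (((L : ℝ) ^ d / L) / (1 - (L : ℝ) ^ d / L * (24 * ε))) + 3 * (1 / (2816 * ((d : ℝ) + 1) * L)) + 1)) B))
          (ContinuousLinearMap.id ℝ (realSub (κΓ 𝔸 L c)) - (hΓ hL V hε0 hε hW hV hV' hbud c).comp
            (reP (κ𝔸 𝔸) κ𝔸_invol ∘L (fderiv ℂ Dt (incl (κΓ 𝔸 L c) B)).restrictScalars ℝ ∘L incl (κΓ 𝔸 L c)))
          (winΓ L c ((1 / (2816 * ((d : ℝ) + 1) * L)) ^ 2 /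
            (18 * (((L : ℝ) ^ d / L) / (1 - (L : ℝ) ^ d / L * (24 * ε))) + 3 * (1 / (2816 * ((d : ℝ) + 1) * L)) + 1)))
          B) ∧
      ∀ B ∈ winΓ L c ((1 / (2816 * ((d : ℝ) + 1) * L)) ^ 2 /
          (18 * (((L : ℝ) ^ d / L) / (1 - (L : ℝ) ^ d / L * (24 * ε))) + 3 * (1 / (2816 * ((d : ℝ) + 1) * L)) + 1)),
        TΓ L V c (B - hΓ hL V hε0 hε hW hV hV' hbud c (DtΓℝ L c Dt
            ((1 / (2816 * ((d : ℝ) + 1) * L)) ^ 2 /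
              (18 * (((L : ℝ) ^ d / L) / (1 - (L : ℝ) ^ d / L * (24 * ε))) + 3 * (1 / (2816 * ((d : ℝ) + 1) * L)) + 1)) B)) +
          (fun y => reP (κ𝔸 𝔸) κ𝔸_invol (nonlin (QtΓ L V c) (incl (κΓ 𝔸 L c) y)))
            (B - hΓ hL V hε0 hε hW hV hV' hbud c (DtΓℝ L c Dt
              ((1 / (2816 * ((d : ℝ) + 1) * L)) ^ 2 /
                (18 * (((L : ℝ) ^ d / L) / (1 - (L : ℝ) ^ d / L * (24 * ε))) + 3 * (1 / (2816 * ((d : ℝ) + 1) * L)) + 1))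
              B)) = (Ψ.symm B).2 := by
  have hLr : (0 : ℝ) < L := by exact_mod_cast hL
  have hR : (0 : ℝ) < 1 / (2816 * ((d : ℝ) + 1) * L) := by positivity
  obtain ⟨hq, hRC⟩ := window_ok hR (ShellMeasureAverageDerivative.hop_bound_nonneg hL hbud)
  obtain ⟨Ψ, hΨ⟩ := exists_splitting_gammaT hL hV hV' hε0 hε hW hbud hR
    (analyticOnNhd_Qtilde_gammaT hL hV hV' hε0 hε (hW c)) (hGen_star_gammaT_unitary hL V hε0 hε hW hV hV' hbud hVu c)
  obtain ⟨Dt, h⟩ := realForm_chartData_gammaT hL hVu hV hV' hε0 hε hW hbud hq hRC Ψ hΨ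
  exact ⟨Ψ, Dt, hΨ, h⟩

end End

/-! ## §3 The matrix typing `𝔸 := M_N(ℂ)` (L²-operator norm) of the owner's row text -/

section MatrixTyping

open scoped Matrix.Norms.L2Operator

variable {N : ℕ} [NeZero N] {L : ℕ} {c : ZdEdge d}
  [MeasurableSpace (Matrix (Fin N) (Fin N) ℂ)] [BorelSpace (Matrix (Fin N) (Fin N) ℂ)]
  [MeasurableSpace (↥(qppBonds L c) → Matrix (Fin N) (Fin N) ℂ)] [BorelSpace (↥(qppBonds L c) → Matrix (Fin N) (Fin N) ℂ)]

/-- **NE7c-S52 AT THE MATRIX TYPING**: for UNITARY `N × N` matrices `V(b)` (`N ≠ 0`; L²-operator = C⋆ norm) with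
`ε`-regular off-axis block loops at every coarse bond (`0 ≤ ε ≤ 1∕8`) and the budget `(Lᵈ∕L)·24ε < 1`, the (LR)_j
real-form chart data for the printed average [B7] (15) at the coarse bond `c` hold — `realForm_chartData_gammaT_explicit`
with every class (`NormedRing`, `NormedAlgebra ℂ`, `CompleteSpace`, `NormOneClass`, `CStarRing`, `StarModule ℂ`,
`FiniteDimensional ℂ`) found by instance resolution; Borel structures by hypothesis (as in S40∕S46). [folklore] -/
theorem realForm_chartData_gammaT_matrix (hL : 0 < L) {V : ZdEdge d → (Matrix (Fin N) (Fin N) ℂ)ˣ}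
    (hVu : ∀ b, (V b : Matrix (Fin N) (Fin N) ℂ) ∈ unitary (Matrix (Fin N) (Fin N) ℂ))
    (hV : ∀ b, ‖((V b : (Matrix (Fin N) (Fin N) ℂ)ˣ) : Matrix (Fin N) (Fin N) ℂ)‖ ≤ 1)
    (hV' : ∀ b, ‖(((V b)⁻¹ : (Matrix (Fin N) (Fin N) ℂ)ˣ) : Matrix (Fin N) (Fin N) ℂ)‖ ≤ 1)
    {ε : ℝ} (hε0 : 0 ≤ ε) (hε : ε ≤ 1 / 8)
    (hW : ∀ c', ∀ x ∈ offAxis L c', ‖((loopW L (fun U : ZdEdge d → (Matrix (Fin N) (Fin N) ℂ)ˣ => gammaT L U) V c' x :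
      (Matrix (Fin N) (Fin N) ℂ)ˣ) : Matrix (Fin N) (Fin N) ℂ) - 1‖ ≤ ε)
    (hbud : (L : ℝ) ^ d / L * (24 * ε) < 1) :
    ∃ (Ψ : (LinearMap.ker ((TΓ L V c : realSub (κΓ (Matrix (Fin N) (Fin N) ℂ) L c) →L[ℝ]
          realSub (κ𝔸 (Matrix (Fin N) (Fin N) ℂ))) : realSub (κΓ (Matrix (Fin N) (Fin N) ℂ) L c) →ₗ[ℝ]
            realSub (κ𝔸 (Matrix (Fin N) (Fin N) ℂ))) × realSub (κ𝔸 (Matrix (Fin N) (Fin N) ℂ))) ≃L[ℝ]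
          realSub (κΓ (Matrix (Fin N) (Fin N) ℂ) L c))
      (Dt : (↥(qppBonds L c) → Matrix (Fin N) (Fin N) ℂ) → Matrix (Fin N) (Fin N) ℂ),
      (∀ y, (Ψ.symm y).2 = TΓ L V c y) ∧
      (∀ B : ↥(qppBonds L c) → Matrix (Fin N) (Fin N) ℂ, ‖B‖ < (1 / (2816 * ((d : ℝ) + 1) * L)) ^ 2 /
          (18 * (((L : ℝ) ^ d / L) / (1 - (L : ℝ) ^ d / L * (24 * ε))) + 3 * (1 / (2816 * ((d : ℝ) + 1) * L)) + 1) →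
        Dt B ∈ closedBall (0 : Matrix (Fin N) (Fin N) ℂ) (4 * Mq (1 / (2816 * ((d : ℝ) + 1) * L)) 1 *
          ((1 / (2816 * ((d : ℝ) + 1) * L)) ^ 2 /
            (18 * (((L : ℝ) ^ d / L) / (1 - (L : ℝ) ^ d / L * (24 * ε))) + 3 * (1 / (2816 * ((d : ℝ) + 1) * L)) + 1)) ^ 2) ∧
        nonlin (QtΓ L V c) (B - hopΓ hL V hε0 hε hW hV hV' hbud c (Dt B)) = Dt B ∧
        QtΓ L V c (B - hopΓ hL V hε0 hε hW hV hV' hbud c (Dt B)) = fderiv ℂ (QtΓ L V c) 0 B) ∧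
      Measurable (fun B : realSub (κΓ (Matrix (Fin N) (Fin N) ℂ) L c) => B - hΓ hL V hε0 hε hW hV hV' hbud c (DtΓℝ L c Dt
        ((1 / (2816 * ((d : ℝ) + 1) * L)) ^ 2 /
          (18 * (((L : ℝ) ^ d / L) / (1 - (L : ℝ) ^ d / L * (24 * ε))) + 3 * (1 / (2816 * ((d : ℝ) + 1) * L)) + 1)) B)) ∧
      InjOn (fun B : realSub (κΓ (Matrix (Fin N) (Fin N) ℂ) L c) => B - hΓ hL V hε0 hε hW hV hV' hbud c (DtΓℝ L c Dt
        ((1 / (2816 * ((d : ℝ) + 1) * L)) ^ 2 /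
          (18 * (((L : ℝ) ^ d / L) / (1 - (L : ℝ) ^ d / L * (24 * ε))) + 3 * (1 / (2816 * ((d : ℝ) + 1) * L)) + 1)) B))
        (winΓ L c ((1 / (2816 * ((d : ℝ) + 1) * L)) ^ 2 /
          (18 * (((L : ℝ) ^ d / L) / (1 - (L : ℝ) ^ d / L * (24 * ε))) + 3 * (1 / (2816 * ((d : ℝ) + 1) * L)) + 1))) ∧
      (∀ B ∈ winΓ L c ((1 / (2816 * ((d : ℝ) + 1) * L)) ^ 2 /
          (18 * (((L : ℝ) ^ d / L) / (1 - (L : ℝ) ^ d / L * (24 * ε))) + 3 * (1 / (2816 * ((d : ℝ) + 1) * L)) + 1)),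
        HasFDerivWithinAt
          (fun B : realSub (κΓ (Matrix (Fin N) (Fin N) ℂ) L c) => B - hΓ hL V hε0 hε hW hV hV' hbud c (DtΓℝ L c Dt
            ((1 / (2816 * ((d : ℝ) + 1) * L)) ^ 2 /
              (18 * (((L : ℝ) ^ d / L) / (1 - (L : ℝ) ^ d / L * (24 * ε))) + 3 * (1 / (2816 * ((d : ℝ) + 1) * L)) + 1)) B))
          (ContinuousLinearMap.id ℝ (realSub (κΓ (Matrix (Fin N) (Fin N) ℂ) L c)) -
            (hΓ hL V hε0 hε hW hV hV' hbud c).comp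
            (reP (κ𝔸 (Matrix (Fin N) (Fin N) ℂ)) κ𝔸_invol ∘L (fderiv ℂ Dt (incl (κΓ (Matrix (Fin N) (Fin N) ℂ) L c) B)).restrictScalars ℝ ∘L
              incl (κΓ (Matrix (Fin N) (Fin N) ℂ) L c)))
          (winΓ L c ((1 / (2816 * ((d : ℝ) + 1) * L)) ^ 2 /
            (18 * (((L : ℝ) ^ d / L) / (1 - (L : ℝ) ^ d / L * (24 * ε))) + 3 * (1 / (2816 * ((d : ℝ) + 1) * L)) + 1)))
          B) ∧
      ∀ B ∈ winΓ L c ((1 / (2816 * ((d : ℝ) + 1) * L)) ^ 2 /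
          (18 * (((L : ℝ) ^ d / L) / (1 - (L : ℝ) ^ d / L * (24 * ε))) + 3 * (1 / (2816 * ((d : ℝ) + 1) * L)) + 1)),
        TΓ L V c (B - hΓ hL V hε0 hε hW hV hV' hbud c (DtΓℝ L c Dt
            ((1 / (2816 * ((d : ℝ) + 1) * L)) ^ 2 /
              (18 * (((L : ℝ) ^ d / L) / (1 - (L : ℝ) ^ d / L * (24 * ε))) + 3 * (1 / (2816 * ((d : ℝ) + 1) * L)) + 1)) B)) +
          (fun y => reP (κ𝔸 (Matrix (Fin N) (Fin N) ℂ)) κ𝔸_invol (nonlin (QtΓ L V c)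
            (incl (κΓ (Matrix (Fin N) (Fin N) ℂ) L c) y)))
            (B - hΓ hL V hε0 hε hW hV hV' hbud c (DtΓℝ L c Dt
              ((1 / (2816 * ((d : ℝ) + 1) * L)) ^ 2 /
                (18 * (((L : ℝ) ^ d / L) / (1 - (L : ℝ) ^ d / L * (24 * ε))) + 3 * (1 / (2816 * ((d : ℝ) + 1) * L)) + 1))
              B)) = (Ψ.symm B).2 :=
  realForm_chartData_gammaT_explicit hL hVu hV hV' hε0 hε hW hbud

end MatrixTyping

end Summit.QuantumFields.BalabanUV.T4Continuum.ShellMeasureLinearizedGammaT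

end
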